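import Literature.Algebra.EuclideanLattices.BabaiIntBackSub
import Literature.Algebra.EuclideanLattices.NearestPlaneGaussian
import Literature.Algebra.EuclideanLattices.GramSchmidtTablePrefix
import Literature.Probability.Distributions.IndepProductLawDistance
import HarnessLib

/-!
# GPV's `SampleD` by back-substitution on integer Gram–Schmidt data, with a pluggable one-dimensional sampler

Topic `Algebra/EuclideanLattices` (family `pqc`), sequel of `NearestPlaneGaussian.lean`
(`GPVSampler.samplePMF k f s c`, the output law of Gentry–Peikert–Vaikuntanathan's randomised nearest
plane `SampleD(B, s, c)` on coefficient vectors, last coefficient first) and of `BabaiIntBackSub.lean`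
(`Babai.intBackSub`: Babai's nearest plane as a back-substitution on ONE table of Cohen's integral
Gram–Schmidt data, `intBackSub_eq_nearestPlane`). Everything here is PROVED; the definitions have bodies;
no named fact.

`SampleD` is Babai's algorithm with the rounding `zⱼ = ⌊c'ⱼ⌉` replaced by a draw `zⱼ ← D_{ℤ,σⱼ,c'ⱼ}`,
`c'ⱼ = ⟪c - ∑_{i>j} zᵢbᵢ, b̃ⱼ⟫/‖b̃ⱼ‖²`, `σⱼ = s/‖b̃ⱼ‖` (GPV 2008, §4.2). On Cohen's data of the extended family
`(b₀, …, b_{n-1}, w)` — `Λⱼ(i) = dⱼ⟪bᵢ, b̃ⱼ⟫`, `Λⱼ(w) = dⱼ⟪w, b̃ⱼ⟫`, `d_{j+1} = dⱼ‖b̃ⱼ‖²`, all integers for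
integer rows — the centre of level `j` is the RATIONAL `Λⱼ(w')/d_{j+1}` of the linearly updated target
row, and the width is coded by the RATIONAL `θⱼ = π/σⱼ² = θ₀·d_{j+1}/dⱼ` as soon as `θ₀ = π/s²` is rational
(the consumer samples the scaled dual lattice `det B·Λ*` at width `s = |det B|·r√(π/3)`, `θ₀ = 3/(det B·r)²`).
A machine therefore runs the back-substitution with a one-dimensional sampler taking `(θ, c') ∈ ℚ²`
— the rejection sampler `GaussRej.rejLaw` of `Probability/Distributions/GaussianRejectionSampler.lean`.
This file defines that recursion for an ARBITRARY kernel `step : ℚ → ℚ → PMF ℤ` and proves: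

* `GPVSampler.backSample step n lamB lamW d θs` — the law of the back-substitution sampler on abstract
  integer data with the width codes `θs`;
* `GPVSampler.exactStep θ c = D_{ℤ,√(π/θ),c}` and **`backSample_exactStep_eq_samplePMF`** — with the exact
  kernel and data `lamB i j = Kⱼ⟪fᵢ, b̃ⱼ⟫`, `lamW j = Kⱼ⟪c, b̃ⱼ⟫`, `d j = Kⱼ‖b̃ⱼ‖²` (`Kⱼ > 0`),
  `θⱼ = π‖b̃ⱼ‖²/s²`, the law IS `samplePMF n f s c` (structural induction, as `intBackSub_eq_nearestPlane`);
* **`backSample_uRec_eq_samplePMF`** — the instance with Cohen's data of the extended family of linearly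
  independent integer rows (`Kⱼ = dⱼ`, `θⱼ = θ₀·dRec (b,w) (j+1)/dRec (b,w) j`, `θ₀ = π/s²`):
  `backSample exactStep = samplePMF n (rows) s w`;
* **`tvDist_backSample_le`** — the hybrid argument: two kernels that are `τ`-close at every
  `(θⱼ, c')` give laws that are `n·τ`-close (`PMF.tvDist_bind_bind_le`, `PMF.tvDist_map_le`).

## References

* C. Gentry, C. Peikert, V. Vaikuntanathan, *Trapdoors for hard lattices and new cryptographic
  constructions*, STOC 2008, §4.2 (SampleD) with §4.1 (SampleZ) [GentryPeikertVaikuntanathan2008].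
* L. Babai, *On Lovász' lattice reduction and the nearest lattice point problem*, Combinatorica 6 (1986),
  §3 [Babai1986].
* H. Cohen, *A Course in Computational Algebraic Number Theory*, GTM 138, Springer 1993, Algorithm 2.6.7
  (integral Gram–Schmidt data) [Cohen1993].
-/

noncomputable section

namespace Literature.Algebra.EuclideanLattices

open InnerProductSpace Finset Real
open scoped RealInnerProductSpace

namespace GPVSampler

/-! ### The recursion on abstract integer data -/

/-- **Back-substitution sampling on integer Gram–Schmidt data.** Data for `n` basis rows: `lamB i j = Λⱼ(bᵢ)`,
`lamW j = Λⱼ(w)` (the target row), `d j = d_{j+1}`, width codes `θs j`; kernel `step θ c'`. Last coefficient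
`z ← step (θ_{n-1}) (Λ_{n-1}(w)/d_n)`; recurse on the prefix levels with the target row
`Λⱼ(w) - z Λⱼ(b_{n-1})`. [cite: GentryPeikertVaikuntanathan2008, §4.2 (SampleD); Babai1986, §3] -/
def backSample (step : ℚ → ℚ → PMF ℤ) :
    (n : ℕ) → (Fin n → Fin n → ℤ) → (Fin n → ℤ) → (Fin n → ℤ) → (Fin n → ℚ) → PMF (Fin n → ℤ)
  | 0, _, _, _, _ => PMF.pure fun i => i.elim0
  | n + 1, lamB, lamW, d, θs =>
      (step (θs (Fin.last n)) ((lamW (Fin.last n) : ℚ) / (d (Fin.last n) : ℚ))).bind fun z =>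
        (backSample step n (fun i j => lamB (Fin.castSucc i) (Fin.castSucc j))
            (fun j => lamW (Fin.castSucc j) - z * lamB (Fin.last n) (Fin.castSucc j))
            (fun j => d (Fin.castSucc j)) (fun j => θs (Fin.castSucc j))).map fun zs => Fin.snoc zs z

/-- Unfolding of one step. [folklore] -/
theorem backSample_succ (step : ℚ → ℚ → PMF ℤ) (n : ℕ) (lamB : Fin (n + 1) → Fin (n + 1) → ℤ)
    (lamW d : Fin (n + 1) → ℤ) (θs : Fin (n + 1) → ℚ) :
    backSample step (n + 1) lamB lamW d θs =
      (step (θs (Fin.last n)) ((lamW (Fin.last n) : ℚ) / (d (Fin.last n) : ℚ))).bind fun z =>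
        (backSample step n (fun i j => lamB (Fin.castSucc i) (Fin.castSucc j))
            (fun j => lamW (Fin.castSucc j) - z * lamB (Fin.last n) (Fin.castSucc j))
            (fun j => d (Fin.castSucc j)) (fun j => θs (Fin.castSucc j))).map fun zs => Fin.snoc zs z := rfl

/-- **The exact kernel**: `D_{ℤ,√(π/θ),c}`, the discrete Gaussian of width code `θ = π/σ²` and centre `c`.
[cite: GentryPeikertVaikuntanathan2008, §4.1] -/
def exactStep (θ c : ℚ) : PMF ℤ := discreteGaussianInt (Real.sqrt (π / θ)) c

/-- One step of `samplePMF`. [cite: GentryPeikertVaikuntanathan2008, §4.2] -/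
theorem samplePMF_succ {V : Type*} [NormedAddCommGroup V] [InnerProductSpace ℝ V] {k : ℕ}
    (f : Fin (k + 1) → V) (s : ℝ) (c : V) :
    samplePMF (k + 1) f s c =
      (discreteGaussianInt (lastWidth f s) (lastCenter f c)).bind fun z =>
        (samplePMF k (f ∘ Fin.castSucc) s (c - (z : ℝ) • f (Fin.last k))).map fun zs => Fin.snoc zs z := rfl

/-! ### With the exact kernel it is GPV's sampler, for any positive scalings -/

variable {V : Type*} [NormedAddCommGroup V] [InnerProductSpace ℝ V]

/-- **Back-substitution sampling on scaled Gram–Schmidt data with the exact kernel is `SampleD`.** If every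
Gram–Schmidt vector of `f` is nonzero, `0 < s`, and the integer data are `lamB i j = Kⱼ⟪fᵢ, b̃ⱼ⟫`,
`lamW j = Kⱼ⟪c, b̃ⱼ⟫`, `d j = Kⱼ‖b̃ⱼ‖²` for positive reals `Kⱼ`, with width codes `θⱼ = π‖b̃ⱼ‖²/s²`, then
`backSample exactStep n lamB lamW d θs = samplePMF n f s c`. [cite: GentryPeikertVaikuntanathan2008, §4.2; Babai1986, §3] -/
theorem backSample_exactStep_eq_samplePMF : ∀ (n : ℕ) (f : Fin n → V) (_ : ∀ j, gramSchmidt ℝ f j ≠ 0)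
    (c : V) {s : ℝ} (_ : 0 < s) (K : Fin n → ℝ) (_ : ∀ j, 0 < K j) (lamB : Fin n → Fin n → ℤ) (lamW d : Fin n → ℤ)
    (θs : Fin n → ℚ)
    (_ : ∀ i j, (lamB i j : ℝ) = K j * ⟪f i, gramSchmidt ℝ f j⟫)
    (_ : ∀ j, (lamW j : ℝ) = K j * ⟪c, gramSchmidt ℝ f j⟫)
    (_ : ∀ j, (d j : ℝ) = K j * ‖gramSchmidt ℝ f j‖ ^ 2)
    (_ : ∀ j, ((θs j : ℚ) : ℝ) = π * ‖gramSchmidt ℝ f j‖ ^ 2 / s ^ 2),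
    backSample exactStep n lamB lamW d θs = samplePMF n f s c
  | 0, _, _, _, _, _, _, _, _, _, _, _, _, _, _, _ => rfl
  | n + 1, f, hf, c, s, hs, K, hK, lamB, lamW, d, θs, hB, hW, hd, hθ => by
      have hgs0 : 0 < ‖gramSchmidt ℝ f (Fin.last n)‖ := norm_pos_iff.2 (hf _)
      have hgs : 0 < ‖gramSchmidt ℝ f (Fin.last n)‖ ^ 2 := pow_pos hgs0 2
      have hK0 : K (Fin.last n) ≠ 0 := (hK _).ne'
      -- the kernel of the last coefficient is `D_{ℤ, s/‖b̃‖, c'}`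
      have hwidth : Real.sqrt (π / θs (Fin.last n)) = lastWidth f s := by
        rw [hθ, lastWidth]
        have : π / (π * ‖gramSchmidt ℝ f (Fin.last n)‖ ^ 2 / s ^ 2) = (s / ‖gramSchmidt ℝ f (Fin.last n)‖) ^ 2 := by
          field_simp
        rw [this, Real.sqrt_sq (div_nonneg hs.le hgs0.le)]
      have hcenter : ((((lamW (Fin.last n) : ℚ) / (d (Fin.last n) : ℚ) : ℚ)) : ℝ) = lastCenter f c := by
        push_cast
        rw [hW, hd, lastCenter]
        field_simp
      have hstep : exactStep (θs (Fin.last n)) ((lamW (Fin.last n) : ℚ) / (d (Fin.last n) : ℚ)) =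
          discreteGaussianInt (lastWidth f s) (lastCenter f c) := by
        rw [exactStep, hwidth, hcenter]
      -- the prefix family: same Gram–Schmidt vectors
      have hprefix : ∀ j : Fin n, gramSchmidt ℝ (f ∘ Fin.castSucc) j = gramSchmidt ℝ f (Fin.castSucc j) :=
        fun j => Literature.Analysis.InnerProduct.gramSchmidt_comp_castSucc ℝ f j
      have hf' : ∀ j : Fin n, gramSchmidt ℝ (f ∘ Fin.castSucc) j ≠ 0 := fun j => by rw [hprefix]; exact hf _
      rw [backSample_succ, samplePMF_succ, hstep]
      congr 1
      funext z
      congr 1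
      exact backSample_exactStep_eq_samplePMF n (f ∘ Fin.castSucc) hf' (c - (z : ℝ) • f (Fin.last n)) hs
        (K ∘ Fin.castSucc) (fun j => hK _)
        (fun i j => lamB (Fin.castSucc i) (Fin.castSucc j))
        (fun j => lamW (Fin.castSucc j) - z * lamB (Fin.last n) (Fin.castSucc j))
        (fun j => d (Fin.castSucc j)) (fun j => θs (Fin.castSucc j))
        (fun i j => by simp only [Function.comp_apply, hprefix]; exact hB _ _)
        (fun j => by
          simp only [Function.comp_apply, hprefix]
          push_cast
          rw [hW, hB, Babai.inner_sub_smul_gramSchmidt]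
          ring)
        (fun j => by simp only [Function.comp_apply, hprefix]; exact hd _)
        (fun j => by simp only [hprefix]; exact hθ _)

/-! ### With Cohen's data of the extended family -/

variable {m : ℕ}

open Babai in
/-- **Back-substitution sampling on Cohen's table of the extended family is `SampleD` on the integer rows**
(linearly independent): with `lamB i j = uRec (b, w) j i j`, `lamW j = uRec (b, w) j n j`,
`d j = dRec (b, w) (j + 1)` and the width codes `θⱼ = θ₀·dRec (b,w) (j+1)/dRec (b,w) j`, `θ₀ = π/s²`,
`backSample exactStep n lamB lamW d θs = samplePMF n (rows of b) s w`.
[cite: GentryPeikertVaikuntanathan2008, §4.2; Cohen1993, Algorithm 2.6.7] -/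
theorem backSample_uRec_eq_samplePMF {n : ℕ} (b : Fin n → (Fin m → ℤ)) (w : Fin m → ℤ)
    (hli : LinearIndependent ℝ (rowsR b)) {s : ℝ} (hs : 0 < s) {θ₀ : ℚ} (hθ₀ : ((θ₀ : ℚ) : ℝ) = π / s ^ 2) :
    backSample exactStep n
        (fun i j => uRec (Fin.snoc b w : Fin (n + 1) → (Fin m → ℤ)) j (Fin.castSucc i) (Fin.castSucc j))
        (fun j => uRec (Fin.snoc b w : Fin (n + 1) → (Fin m → ℤ)) j (Fin.last n) (Fin.castSucc j))
        (fun j => dRec (Fin.snoc b w : Fin (n + 1) → (Fin m → ℤ)) (j + 1))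
        (fun j => θ₀ * dRec (Fin.snoc b w : Fin (n + 1) → (Fin m → ℤ)) (j + 1) /
          dRec (Fin.snoc b w : Fin (n + 1) → (Fin m → ℤ)) j) =
      samplePMF n (rowsR b) s (intVecToEuclidean m w) := by
  have hgs : ∀ j, gramSchmidt ℝ (rowsR b) j ≠ 0 := fun j => gramSchmidt_ne_zero j hli
  have hKpos : ∀ j : Fin n, 0 < gramDet (rowsR b) j (le_of_lt j.isLt) :=
    fun j => lt_of_lt_of_le one_pos (one_le_gramDet b hli j (le_of_lt j.isLt))
  refine backSample_exactStep_eq_samplePMF n (rowsR b) hgs (intVecToEuclidean m w) hs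
    (fun j => gramDet (rowsR b) j (le_of_lt j.isLt)) hKpos _ _ _ _
    (fun i j => ?_) (fun j => ?_) (fun j => dRec_snoc_succ_cast b w hli j) (fun j => ?_)
  · rw [uRec_snoc_level_cast b w hli]
    congr 1
    exact congrArg (fun v => ⟪v, gramSchmidt ℝ (rowsR b) j⟫) (congrFun (rowsR_snoc_comp_castSucc b w) i)
  · rw [uRec_snoc_level_cast b w hli, rowsR_snoc_last]
  · -- `θ₀ d_{j+1}/d_j = (π/s²)‖b̃ⱼ‖²`
    have hdj : (dRec (Fin.snoc b w : Fin (n + 1) → (Fin m → ℤ)) j : ℝ) = gramDet (rowsR b) j (le_of_lt j.isLt) := by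
      have hpre : (Fin.snoc b w : Fin (n + 1) → (Fin m → ℤ)) ∘ Fin.castLE n.le_succ = b := by
        funext i
        have : Fin.castLE n.le_succ i = Fin.castSucc i := Fin.ext rfl
        simp only [Function.comp_apply, this, Fin.snoc_castSucc]
      have hli' : LinearIndependent ℝ (⇑(intVecToEuclidean m).toAddMonoidHom ∘
          ((Fin.snoc b w : Fin (n + 1) → (Fin m → ℤ)) ∘ Fin.castLE n.le_succ)) := by
        rw [hpre]; exact hli
      have h := dRec_cast_eq_gramDet_of_prefix (Fin.snoc b w : Fin (n + 1) → (Fin m → ℤ)) n.le_succ hli' j (le_of_lt j.isLt)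
      rw [h]
      exact gramDet_rowsR_snoc b w j (le_of_lt j.isLt)
    push_cast
    rw [dRec_snoc_succ_cast b w hli j, hdj, hθ₀]
    have hK0 : gramDet (rowsR b) j (le_of_lt j.isLt) ≠ 0 := (hKpos j).ne'
    field_simp

/-! ### Two kernels: the hybrid argument -/

/-- **Kernels `τ`-close at every width code and centre give laws `n·τ`-close**: one level costs
`Δ(step₁(θ_{n-1}, c'), step₂(θ_{n-1}, c'))` plus, uniformly in the drawn coefficient, the distance of the
recursive calls (`PMF.tvDist_bind_bind_le`; pushing along `snoc` is data processing).
[cite: GentryPeikertVaikuntanathan2008, §4.2 (proof of Thm. 4.1: "by a hybrid argument")] -/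
theorem tvDist_backSample_le (step₁ step₂ : ℚ → ℚ → PMF ℤ) {τ : ℝ} (hτ : 0 ≤ τ) :
    ∀ (n : ℕ) (lamB : Fin n → Fin n → ℤ) (lamW d : Fin n → ℤ) (θs : Fin n → ℚ)
      (_ : ∀ j c, (step₁ (θs j) c).tvDist (step₂ (θs j) c) ≤ τ),
      (backSample step₁ n lamB lamW d θs).tvDist (backSample step₂ n lamB lamW d θs) ≤ n * τ
  | 0, _, _, _, _, _ => by simp [backSample]
  | n + 1, lamB, lamW, d, θs, hstep => by
      rw [backSample_succ, backSample_succ]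
      set lamB' : Fin n → Fin n → ℤ := fun i j => lamB (Fin.castSucc i) (Fin.castSucc j) with hlamB'
      set lamW' : ℤ → Fin n → ℤ := fun z j => lamW (Fin.castSucc j) - z * lamB (Fin.last n) (Fin.castSucc j) with hlamW'
      set d' : Fin n → ℤ := fun j => d (Fin.castSucc j) with hd'
      set θs' : Fin n → ℚ := fun j => θs (Fin.castSucc j) with hθs'
      have hstep' : ∀ j c, (step₁ (θs' j) c).tvDist (step₂ (θs' j) c) ≤ τ := fun j c => hstep (Fin.castSucc j) c
      have hrec : ∀ z : ℤ,
          ((backSample step₁ n lamB' (lamW' z) d' θs').map fun zs : Fin n → ℤ => (Fin.snoc zs z : Fin (n + 1) → ℤ)).tvDist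
            ((backSample step₂ n lamB' (lamW' z) d' θs').map fun zs : Fin n → ℤ => (Fin.snoc zs z : Fin (n + 1) → ℤ)) ≤ n * τ := by
        intro z
        have h1 := PMF.tvDist_map_le_holds (fun zs : Fin n → ℤ => (Fin.snoc zs z : Fin (n + 1) → ℤ))
          (backSample step₁ n lamB' (lamW' z) d' θs') (backSample step₂ n lamB' (lamW' z) d' θs')
        have h2 := tvDist_backSample_le step₁ step₂ hτ n lamB' (lamW' z) d' θs' hstep'
        exact h1.trans h2
      have hbb := PMF.tvDist_bind_bind_le (step₁ (θs (Fin.last n)) ((lamW (Fin.last n) : ℚ) / (d (Fin.last n) : ℚ)))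
        (step₂ (θs (Fin.last n)) ((lamW (Fin.last n) : ℚ) / (d (Fin.last n) : ℚ)))
        (fun z => (backSample step₁ n lamB' (lamW' z) d' θs').map fun zs : Fin n → ℤ => (Fin.snoc zs z : Fin (n + 1) → ℤ))
        (fun z => (backSample step₂ n lamB' (lamW' z) d' θs').map fun zs : Fin n → ℤ => (Fin.snoc zs z : Fin (n + 1) → ℤ)) hrec
      refine hbb.trans ?_
      push_cast
      linarith [hstep (Fin.last n) ((lamW (Fin.last n) : ℚ) / (d (Fin.last n) : ℚ))]

end GPVSampler

end Literature.Algebra.EuclideanLattices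

end
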